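import Literature.Geometry.Lorentzian.MultiCentreKerrSchild
import HarnessLib

/-!
# Boosted Kerr–Schild fields: joint smoothness, scaling, and far-field decay of all derivatives

Companion to `KerrConvergenceProofs.lean` and `MultiCentreKerrSchild.lean` (family `gr`). That file proves the `1/r` decay of all
derivatives of the Kerr–Schild perturbation `g_{M,a} − η` (`Kerr.norm_iteratedFDeriv_ksPert_le`)
and deduces that the radiation zone of a chart converging to ONE Kerr hole AT REST converges to
Minkowski space (`Spacetime.tendsto_deviationCk_backgroundOn`). The `N`-black-hole final state
(`FinalStateDecomposition`, `KerrConvergence.lean`) and every multi-centre ansatz built from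
`boostedKerrBilin Λ c M a` (Kerr–Schild 1965, §2: Lorentz covariance of the ansatz `η + 2H ℓ ⊗ ℓ`)
need the BOOSTED, TRANSLATED and SUPERPOSED versions, which this file supplies:

* `lorentzGroup.minkowski_symm_apply` — `Λ⁻¹` preserves `η` (O'Neill 1983, Ch. 9);
* `contDiffAt_boostedKsPert`, `contDiffAt_boostedKerrBilin₂` — smoothness of the boosted
  perturbation, and JOINT smoothness in `(a', y)`, wherever the rest-frame Kerr–Schild radius is
  positive (the single-point version `contDiffAt_boostedKerrBilin` is in
  `MultiCentreKerrSchild.lean`, which this file imports);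
* `norm_iteratedFDeriv_boostedKsPert_le` — **`‖D^m (boostedKerrBilin Λ c M a − η)(x)‖ ≤ C / r`**,
  `r = r_a(Λ⁻¹(x − c)) ≥ R`, by SCALING (homogeneity of the Kerr–Schild data transported by `Λ⁻¹`,
  stationarity along `Λe₀`, compactness of the boosted unit shell), exactly as
  `Kerr.norm_iteratedFDeriv_ksPert_le`;
* `boostedKsPert_smul`, `boostedKsPert_add_smul_apply`, `iteratedFDeriv_boostedKsPert_add_smul`,
  `exists_bound_iteratedFDeriv_boostedKsPert_one` — scaling law, stationarity along `Λe₀`, and the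
  uniform bound on the boosted unit shell (the ingredients of the scaling proof, as in
  `KerrConvergenceProofs`).

The radiation zone of a chart converging to a SUPERPOSITION of boosted Kerr–Schild fields is
treated in `MultiCentreRadiationZone.lean`.

## References

* R. P. Kerr, A. Schild, *A new class of vacuum solutions of the Einstein field equations* (1965),
  §2 (key `KerrSchild1965`).
* B. O'Neill, *Semi-Riemannian geometry*, 1983, Ch. 9, pp. 233–236 (key `ONeill1983`).
* M. Dafermos, G. Holzegel, I. Rodnianski, M. Taylor, arXiv:2104.08222, §1 (`arXiv210408222`).
-/

noncomputable section

open TopologicalSpace Manifold Filter Topology Set Function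
open scoped ContDiff Topology ENNReal BigOperators

universe u

namespace Literature.Geometry.Lorentzian

/-! ### Lorentz transformations: the inverse preserves `η` -/

/-- For `Λ` in the Lorentz group, `Λ⁻¹ = Λ.symm` preserves the Minkowski form (a subgroup is closed
under inverses; O'Neill 1983, Ch. 9, p. 233). [cite: ONeill1983, Ch. 9, p. 233] -/
theorem lorentzGroup.minkowski_symm_apply (Λ : lorentzGroup) (v w : E4) :
    Minkowski.bilin ((Λ : E4 ≃L[ℝ] E4).symm v) ((Λ : E4 ≃L[ℝ] E4).symm w) = Minkowski.bilin v w :=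
  (lorentzGroup.inv_mem Λ.2) v w

/-! ### Smoothness of the boosted perturbation -/

section Boosted

variable (Λ : lorentzGroup)

variable {Λ} in
/-- **The boosted Kerr–Schild perturbation is `C^n` wherever the rest-frame radius is positive**
(`contDiffAt_boostedKerrBilin` of `MultiCentreKerrSchild.lean`; Kerr–Schild 1965, §3).
[cite: KerrSchild1965, §3] -/
theorem contDiffAt_boostedKsPert {c : E4} {M a : ℝ} {x : E4}
    (hx : 0 < Kerr.radius a (poincareInv Λ c x)) {n : WithTop ℕ∞} :
    ContDiffAt ℝ n (fun y ↦ boostedKerrBilin Λ c M a y - Minkowski.bilin) x :=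
  (contDiffAt_boostedKerrBilin Λ c M a hx).sub contDiffAt_const

/-- **Joint smoothness in the rotation parameter and the point**: `(a', y) ↦ boostedKerrBilin Λ c M a' y`
is `C^n` wherever the rest-frame radius is positive (from `Kerr.contDiffAt_ksPert₂` composed with
the affine map `(a', y) ↦ (a', Λ⁻¹(y − c))`, then pre/post-composition with the constant `Λ⁻¹`,
`ContDiffAt.clm_comp`). Kerr–Schild 1965, §3. [cite: KerrSchild1965, §3] -/
theorem contDiffAt_boostedKerrBilin₂ (c : E4) (M : ℝ) {p : ℝ × E4}
    (hp : 0 < Kerr.radius p.1 (poincareInv Λ c p.2)) {n : WithTop ℕ∞} :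
    ContDiffAt ℝ n (fun q : ℝ × E4 ↦ boostedKerrBilin Λ c M q.1 q.2) p := by
  have hq : ContDiffAt ℝ n (fun q : ℝ × E4 ↦ (q.1, poincareInv Λ c q.2)) p :=
    contDiffAt_fst.prodMk ((contDiff_poincareInv Λ c).contDiffAt.comp p contDiffAt_snd)
  have hk : ContDiffAt ℝ n (fun q : ℝ × E4 ↦ Kerr.bilin 1 q.1 q.2 - Minkowski.bilin)
      (p.1, poincareInv Λ c p.2) := Kerr.contDiffAt_ksPert₂ (p := (p.1, poincareInv Λ c p.2)) hp
  have hks : ContDiffAt ℝ n (fun q : ℝ × E4 ↦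
      Kerr.bilin 1 q.1 (poincareInv Λ c q.2) - Minkowski.bilin) p := hk.comp p hq
  -- `g_{M,a'} = η + M (g_{1,a'} − η)` (the Kerr–Schild term is linear in `M`)
  have hKb : ContDiffAt ℝ n (fun q : ℝ × E4 ↦ Kerr.bilin M q.1 (poincareInv Λ c q.2)) p := by
    have h1 := (contDiffAt_const (c := Minkowski.bilin)).add (hks.const_smul M)
    refine h1.congr_of_eventuallyEq (Eventually.of_forall fun q ↦ ?_)
    show Kerr.bilin M q.1 (poincareInv Λ c q.2) =
      Minkowski.bilin + M • (Kerr.bilin 1 q.1 (poincareInv Λ c q.2) - Minkowski.bilin)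
    rw [Kerr.ksPert_eq, Kerr.bilin, smul_smul]
    congr 1
    unfold Kerr.scalarH
    congr 1
    ring
  exact contDiffAt_const.clm_comp (hKb.clm_comp contDiffAt_const)

/-! ### Scaling and stationarity of the boosted perturbation -/

/-- The inverse Poincaré map without translation is `Λ⁻¹`. [folklore] -/
theorem poincareInv_zero (y : E4) : poincareInv Λ 0 y = (Λ : E4 ≃L[ℝ] E4).symm y := by
  rw [poincareInv, sub_zero]

/-- **Scaling law of the boosted Kerr–Schild perturbation**:
`(boostedKerrBilin Λ c M a − η)(x) = ε M · (boostedKerrBilin Λ 0 1 (εa) − η)(ε(x − c))` for `ε > 0`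
(homogeneity of the Kerr–Schild data, `Kerr.ksPert_smul`, transported by the linear map `Λ⁻¹`).
[cite: KerrSchild1965, §2] -/
theorem boostedKsPert_smul {ε : ℝ} (hε : 0 < ε) (c : E4) (M a : ℝ) (x : E4) :
    boostedKerrBilin Λ c M a x - Minkowski.bilin =
      (ε * M) • (boostedKerrBilin Λ 0 1 (ε * a) (ε • (x - c)) - Minkowski.bilin) := by
  have hP : poincareInv Λ 0 (ε • (x - c)) = ε • poincareInv Λ c x := by
    rw [poincareInv_zero, map_smul]
    rfl
  refine ContinuousLinearMap.ext fun v ↦ ContinuousLinearMap.ext fun w ↦ ?_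
  rw [smul_apply, smul_apply, boostedKerrBilin_sub_minkowski_apply,
    boostedKerrBilin_sub_minkowski_apply, Kerr.ksPert_smul hε M a (poincareInv Λ c x), hP,
    smul_apply, smul_apply]

/-- **Stationarity of the boosted perturbation along the boosted time axis**: translating the
point by `s Λe₀` does not change `boostedKerrBilin Λ c M a − η` (the rest-frame point moves by
`s e₀`, and the Kerr–Schild form is stationary, `Kerr.ksPert_eq_of_spatial_eq`).
[cite: KerrSchild1965, §2] -/
theorem boostedKsPert_add_smul_apply (c : E4) (M a : ℝ) (y : E4) (s : ℝ) :
    boostedKerrBilin Λ c M a (y + s • (Λ : E4 ≃L[ℝ] E4) (E4.basisVector 0)) - Minkowski.bilin =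
      boostedKerrBilin Λ c M a y - Minkowski.bilin := by
  have hsp : E4.spatial (poincareInv Λ c (y + s • (Λ : E4 ≃L[ℝ] E4) (E4.basisVector 0))) =
      E4.spatial (poincareInv Λ c y) := by
    have h1 : poincareInv Λ c (y + s • (Λ : E4 ≃L[ℝ] E4) (E4.basisVector 0)) =
        poincareInv Λ c y + s • E4.basisVector 0 := by
      rw [poincareInv, poincareInv, add_sub_right_comm, map_add, map_smul,
        ContinuousLinearEquiv.symm_apply_apply]
    have h0 : E4.spatial (E4.basisVector 0) = 0 := by
      ext i
      simp [E4.spatial_apply, Fin.succ_ne_zero]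
    rw [h1, map_add, map_smul, h0, smul_zero, add_zero]
  refine ContinuousLinearMap.ext fun v ↦ ContinuousLinearMap.ext fun w ↦ ?_
  rw [boostedKerrBilin_sub_minkowski_apply, boostedKerrBilin_sub_minkowski_apply,
    Kerr.ksPert_eq_of_spatial_eq M a hsp]

/-- Hence all iterated derivatives of the boosted perturbation agree at points differing by a
multiple of `Λe₀` (translation invariance of `iteratedFDeriv`). [cite: KerrSchild1965, §2] -/
theorem iteratedFDeriv_boostedKsPert_add_smul (c : E4) (M a : ℝ) (m : ℕ) (y : E4) (s : ℝ) :
    iteratedFDeriv ℝ m (fun y ↦ boostedKerrBilin Λ c M a y - Minkowski.bilin)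
        (y + s • (Λ : E4 ≃L[ℝ] E4) (E4.basisVector 0)) =
      iteratedFDeriv ℝ m (fun y ↦ boostedKerrBilin Λ c M a y - Minkowski.bilin) y := by
  have hfun : (fun z ↦ boostedKerrBilin Λ c M a (z + s • (Λ : E4 ≃L[ℝ] E4) (E4.basisVector 0)) -
      Minkowski.bilin) = fun y ↦ boostedKerrBilin Λ c M a y - Minkowski.bilin :=
    funext fun z ↦ boostedKsPert_add_smul_apply Λ c M a z s
  have key := iteratedFDeriv_comp_add_right (𝕜 := ℝ)
    (f := fun y ↦ boostedKerrBilin Λ c M a y - Minkowski.bilin) m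
    (s • (Λ : E4 ≃L[ℝ] E4) (E4.basisVector 0)) y
  rw [hfun] at key
  exact key.symm

/-! ### Uniform bound on the boosted unit shell, and decay of all derivatives -/

/-- **Uniform bound on the boosted unit shell.** For every order `m` there is `B` with
`‖D^m (boostedKerrBilin Λ 0 1 a' − η)(y)‖ ≤ B` for all `|a'| ≤ 1/2` and all `y` whose rest-frame
point `Λ⁻¹y` has time `0` and unit spatial norm (continuity of `D^m` of the jointly smooth
perturbation — smooth boost map after `Kerr.contDiffAt_ksPert₂` after a linear map — on a
compact subset of `{r > 0}`). [cite: KerrSchild1965, §3] -/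
theorem exists_bound_iteratedFDeriv_boostedKsPert_one (m : ℕ) :
    ∃ B : ℝ, ∀ a' : ℝ, |a'| ≤ 1 / 2 → ∀ y : E4, poincareInv Λ 0 y 0 = 0 →
      E4.spatialNorm (poincareInv Λ 0 y) = 1 →
      (‖iteratedFDeriv ℝ m (fun y ↦ boostedKerrBilin Λ 0 1 a' y - Minkowski.bilin) y‖ : ℝ) ≤
        B := by
  set P : E4 → E4 := poincareInv Λ 0 with hPdef
  have hPc : Continuous P := continuous_poincareInv Λ 0
  set O : Set (ℝ × E4) := {p | 0 < Kerr.radius p.1 (P p.2)} with hO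
  have hOo : IsOpen O := by
    refine isOpen_lt continuous_const ?_
    simp only [hPdef]
    unfold Kerr.radius E4.spatialNorm poincareInv
    fun_prop
  set g : ℝ × E4 → E4 →L[ℝ] E4 →L[ℝ] ℝ :=
    fun q ↦ boostedKerrBilin Λ 0 1 q.1 q.2 - Minkowski.bilin with hg
  have hcd : ContDiffOn ℝ ∞ g O := fun p hp ↦
    ((contDiffAt_boostedKerrBilin₂ Λ 0 1 hp).sub contDiffAt_const).contDiffWithinAt
  have hcont : ContinuousOn (iteratedFDeriv ℝ m g) O := by
    have h1 := hcd.continuousOn_iteratedFDerivWithin (m := m) (by exact_mod_cast le_top)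
      hOo.uniqueDiffOn
    exact h1.congr fun p hp ↦ (iteratedFDerivWithin_of_isOpen m hOo hp).symm
  set K : Set (ℝ × E4) :=
    Set.Icc (-(1 / 2 : ℝ)) (1 / 2) ×ˢ {y : E4 | P y 0 = 0 ∧ E4.spatialNorm (P y) = 1} with hK
  have hsn : Continuous E4.spatialNorm := continuous_norm.comp E4.spatial.continuous
  have hc0 : Continuous fun y : E4 ↦ y 0 := PiLp.continuous_apply 2 _ 0
  have hKc : IsCompact K := by
    refine isCompact_Icc.prod ?_
    have hclosed : IsClosed {y : E4 | P y 0 = 0 ∧ E4.spatialNorm (P y) = 1} :=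
      (isClosed_eq (hc0.comp hPc) continuous_const).inter
        (isClosed_eq (hsn.comp hPc) continuous_const)
    refine Metric.isCompact_of_isClosed_isBounded hclosed ?_
    refine (Metric.isBounded_closedBall (x := (0 : E4))
      (r := ‖((Λ : E4 ≃L[ℝ] E4) : E4 →L[ℝ] E4)‖)).subset ?_
    intro y hy
    rw [Metric.mem_closedBall, dist_zero_right]
    have hsq : ‖P y‖ ^ 2 = 1 := by
      have h' := E4.spatialNorm_sq (P y)
      rw [hy.2] at h'
      rw [EuclideanSpace.real_norm_sq_eq, Fin.sum_univ_four, hy.1]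
      nlinarith [h']
    have hPy : ‖P y‖ = 1 := by nlinarith [norm_nonneg (P y)]
    have hy' : y = (Λ : E4 ≃L[ℝ] E4) (P y) := by
      rw [hPdef, poincareInv_zero, ContinuousLinearEquiv.apply_symm_apply]
    calc ‖y‖ = ‖((Λ : E4 ≃L[ℝ] E4) : E4 →L[ℝ] E4) (P y)‖ := by
          rw [ContinuousLinearEquiv.coe_coe, ← hy']
      _ ≤ ‖((Λ : E4 ≃L[ℝ] E4) : E4 →L[ℝ] E4)‖ * ‖P y‖ := ContinuousLinearMap.le_opNorm _ _
      _ = _ := by rw [hPy, mul_one]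
  have hKO : K ⊆ O := by
    rintro ⟨a', y⟩ ⟨ha', hy⟩
    change 0 < Kerr.radius a' (P y)
    apply Kerr.radius_pos_of_abs_lt
    rw [hy.2, abs_lt]
    constructor <;> linarith [ha'.1, ha'.2]
  obtain ⟨C, hC⟩ := hKc.exists_bound_of_continuousOn (hcont.mono hKO)
  refine ⟨C, fun a' ha' y hy0 hy1 ↦ ?_⟩
  have hmem : (a', y) ∈ K := ⟨⟨by linarith [(abs_le.mp ha').1], (abs_le.mp ha').2⟩, hy0, hy1⟩
  have hslice := Kerr.norm_iteratedFDeriv_slice_le hOo hcd (hKO hmem) (i := m)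
    (by exact_mod_cast le_top)
  exact hslice.trans (hC _ hmem)

/-- **Decay of all derivatives of the boosted Kerr–Schild perturbation**: for every `m` there are
`C` and `R > 0` with `‖D^m (boostedKerrBilin Λ c M a − η)(x)‖ ≤ C / r_a(Λ⁻¹(x − c))` whenever
`r_a(Λ⁻¹(x − c)) ≥ R` (in fact `O(r^{-1-m})`; only `O(r⁻¹)` is recorded). Proof by scaling, as for
`Kerr.norm_iteratedFDeriv_ksPert_le`: with `z = Λ⁻¹(x − c)` and `ε = 1/‖z⃗‖`, first translate `x`
along `Λe₀` to kill `z⁰` (`iteratedFDeriv_boostedKsPert_add_smul`), then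
`(boostedKerrBilin Λ c M a − η) = ε M (boostedKerrBilin Λ 0 1 (εa) − η) ∘ (ε(· − c))`
(`boostedKsPert_smul`) gives `‖D^m‖ ≤ ε^{m+1} |M| B` with the boosted unit-shell bound `B`.
Kerr–Schild 1965, §2–§3 (Lorentz covariance and asymptotic flatness of the ansatz).
[cite: KerrSchild1965, §3] -/
theorem norm_iteratedFDeriv_boostedKsPert_le (c : E4) (M a : ℝ) (m : ℕ) :
    ∃ C R : ℝ, 0 < R ∧ ∀ x : E4, R ≤ Kerr.radius a (poincareInv Λ c x) →
      (‖iteratedFDeriv ℝ m (fun y ↦ boostedKerrBilin Λ c M a y - Minkowski.bilin) x‖ : ℝ) ≤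
        C / Kerr.radius a (poincareInv Λ c x) := by
  obtain ⟨B, hB⟩ := exists_bound_iteratedFDeriv_boostedKsPert_one Λ m
  refine ⟨|M| * max B 0, max 1 (2 * |a|), lt_max_of_lt_left one_pos, fun x hx ↦ ?_⟩
  set A : E4 ≃L[ℝ] E4 := (Λ : E4 ≃L[ℝ] E4).symm with hA
  set z : E4 := poincareInv Λ c x with hz
  set s := E4.spatialNorm z with hs
  have hr1 : 1 ≤ Kerr.radius a z := (le_max_left _ _).trans hx
  have hr0 : 0 < Kerr.radius a z := one_pos.trans_le hr1
  have hrs : Kerr.radius a z ≤ s := Kerr.radius_le_spatialNorm a z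
  have hs1 : 1 ≤ s := hr1.trans hrs
  have hs0 : 0 < s := one_pos.trans_le hs1
  have hsa : 2 * |a| ≤ s := (le_max_right _ _).trans (hx.trans hrs)
  set ε := s⁻¹ with hε
  have hε0 : 0 < ε := inv_pos.mpr hs0
  have hε1 : ε ≤ 1 := inv_le_one_of_one_le₀ hs1
  -- kill the rest-frame time coordinate by a translation along `Λe₀`
  set x' : E4 := x + (-(z 0)) • (Λ : E4 ≃L[ℝ] E4) (E4.basisVector 0) with hx'
  have hz' : poincareInv Λ c x' = z - z 0 • E4.basisVector 0 := by
    rw [hx', poincareInv, add_sub_right_comm, map_add, map_smul,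
      ContinuousLinearEquiv.symm_apply_apply, neg_smul, ← sub_eq_add_neg]
    rfl
  have hder := iteratedFDeriv_boostedKsPert_add_smul Λ c M a m x (-(z 0))
  have hsp : E4.spatial (poincareInv Λ c x') = E4.spatial z := by
    have h0 : E4.spatial (E4.basisVector 0) = 0 := by
      ext i
      simp [E4.spatial_apply, Fin.succ_ne_zero]
    rw [hz', map_sub, map_smul, h0, smul_zero, sub_zero]
  have hz'0 : poincareInv Λ c x' 0 = 0 := by
    rw [hz']
    simp
  have hrx' : Kerr.radius a (poincareInv Λ c x') = Kerr.radius a z :=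
    Kerr.radius_eq_of_spatial_eq a hsp
  have hsx' : E4.spatialNorm (poincareInv Λ c x') = s := by
    rw [hs, E4.spatialNorm, E4.spatialNorm, hsp]
  -- the rescaled rest-frame point on the unit shell
  set y₁ : E4 := ε • (x' - c) with hy₁
  have hPy₁ : poincareInv Λ 0 y₁ = ε • poincareInv Λ c x' := by
    rw [hy₁, poincareInv_zero, map_smul]
    rfl
  have hy₁0 : poincareInv Λ 0 y₁ 0 = 0 := by
    rw [hPy₁]
    simp [hz'0]
  have hy₁1 : E4.spatialNorm (poincareInv Λ 0 y₁) = 1 := by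
    rw [hPy₁, Kerr.spatialNorm_smul, abs_of_pos hε0, hsx', hε, inv_mul_cancel₀ hs0.ne']
  have ha' : |ε * a| ≤ 1 / 2 := by
    rw [abs_mul, abs_of_pos hε0, hε]
    rw [inv_mul_le_iff₀ hs0]
    linarith
  -- smoothness of the rescaled boosted perturbation at `ε x'`
  have hrad₁ : 0 < Kerr.radius (ε * a) (poincareInv Λ 0 (ε • x' - ε • c)) := by
    rw [← smul_sub, ← hy₁, hPy₁, Kerr.radius_smul hε0, hrx']
    exact mul_pos hε0 hr0
  have hG : ContDiffAt ℝ m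
      (fun w ↦ boostedKerrBilin Λ 0 1 (ε * a) (w - ε • c) - Minkowski.bilin) (ε • x') := by
    have h1 : ContDiffAt ℝ m (fun w ↦ boostedKerrBilin Λ 0 1 (ε * a) w - Minkowski.bilin)
        (ε • x' - ε • c) := contDiffAt_boostedKsPert hrad₁
    exact h1.comp (ε • x') (contDiffAt_id.sub contDiffAt_const)
  -- scaling of the iterated derivative
  have hfun : (fun y ↦ boostedKerrBilin Λ c M a y - Minkowski.bilin) =
      fun y ↦ (ε * M) • (fun w ↦ boostedKerrBilin Λ 0 1 (ε * a) (w - ε • c) - Minkowski.bilin)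
        (ε • y) := by
    funext y
    rw [boostedKsPert_smul Λ hε0 c M a y, smul_sub]
  have hkey := norm_iteratedFDeriv_const_smul_comp_smul_le
    (fun w ↦ boostedKerrBilin Λ 0 1 (ε * a) (w - ε • c) - Minkowski.bilin) (ε * M) hε0.ne' x'
    (m := m) hG
  have htrans : iteratedFDeriv ℝ m
      (fun w ↦ boostedKerrBilin Λ 0 1 (ε * a) (w - ε • c) - Minkowski.bilin) (ε • x') =
      iteratedFDeriv ℝ m (fun y ↦ boostedKerrBilin Λ 0 1 (ε * a) y - Minkowski.bilin) y₁ := by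
    rw [iteratedFDeriv_comp_sub (f := fun y ↦ boostedKerrBilin Λ 0 1 (ε * a) y - Minkowski.bilin)
      m (ε • c) (ε • x'), hy₁, smul_sub]
  have hεm : |ε| ^ m ≤ 1 := pow_le_one₀ (abs_nonneg ε) (by rwa [abs_of_pos hε0])
  have hB0 : 0 ≤ max B 0 := le_max_right _ _
  calc (‖iteratedFDeriv ℝ m (fun y ↦ boostedKerrBilin Λ c M a y - Minkowski.bilin) x‖ : ℝ)
      = ‖iteratedFDeriv ℝ m (fun y ↦ boostedKerrBilin Λ c M a y - Minkowski.bilin) x'‖ := by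
        rw [hder]
    _ = ‖iteratedFDeriv ℝ m (fun y ↦ (ε * M) •
          (fun w ↦ boostedKerrBilin Λ 0 1 (ε * a) (w - ε • c) - Minkowski.bilin) (ε • y)) x'‖ := by
        rw [← hfun]
    _ ≤ |ε * M| * |ε| ^ m * ‖iteratedFDeriv ℝ m
          (fun w ↦ boostedKerrBilin Λ 0 1 (ε * a) (w - ε • c) - Minkowski.bilin) (ε • x')‖ := hkey
    _ ≤ |ε * M| * 1 * max B 0 := by
        rw [htrans]
        gcongr
        exact (hB _ ha' y₁ hy₁0 hy₁1).trans (le_max_left _ _)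
    _ = ε * (|M| * max B 0) := by
        rw [abs_mul, abs_of_pos hε0]
        ring
    _ ≤ (Kerr.radius a z)⁻¹ * (|M| * max B 0) :=
        mul_le_mul_of_nonneg_right (inv_anti₀ hr0 hrs) (by positivity)
    _ = |M| * max B 0 / Kerr.radius a z := by rw [div_eq_inv_mul]

end Boosted

end Literature.Geometry.Lorentzian

end
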